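import Summits.ValiantsHypothesis.ValiantsHypothesis.Theorems.GrenetZeonDualUnipotentThreeHalvesHeavyTopThmCUniform
import Summits.ValiantsHypothesis.ValiantsHypothesis.Theorems.GrenetZeonDualUnipotentThreeHalvesHeavyTopSingleDatumCells
import Summits.ValiantsHypothesis.ValiantsHypothesis.Theorems.GrenetZeonDualUnipotentThreeHalvesHeavyTopInstFifteenTwentyOne
import Summits.ValiantsHypothesis.ValiantsHypothesis.Theorems.DualUnipotentThreeHalves.Negative.HeavyTopInstTenTwentyFive

/-!
# `GrenetZeon.DualUnipotentThreeHalves` (stmt-ValiantsHypothesis-24318), R2 heavy-top instrument — corollaries of the uniform THEOREM C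
# for the census GRID: the `ι`-column by name, row `n = 10` as far as the kernel knows it, and `(7,10)` down to ONE datum

Experiment cell «val-heavytop-census» (D-0160), engine seat val-htc-eng-1 g5.  Book-keeping consequences of ✓ `…HeavyTopThmCUniform.iota_le`
(`ι(s+1) ≤ C(s+1,2) − 2` for every `s ≥ 3`):

* `iota_le_choose_two_sub_two` — the same bound in the `Fin n`, `n ≥ 4` shape used by the composition-bound rows;
* `iota_eight_le` (`≤ 26`), `iota_nine_le` (`≤ 34`), `iota_ten_le` (`≤ 43`) — named kernel entries of the GRID §B `ι`-column
  (with ✓ `iota_5_le`, ✓ `iota_6_le`, ✓ `iota_seven_le_nineteen`, ✓ `iota_fourteen_le`);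
* `heavyTopInst_seven_ten_of_iota10` — the cell `(7,10)` from the ONE datum `ι(10) ≤ 41` (`ι(9) ≤ 34` is now kernel; `ι(10) ≤ 41 = C(10,2) − 4` is OPEN);
* `heavyTopInst_ten_of_le_fourteen`, `instanceTable_n10` — row `10`: `m ≤ 14` TRUE (closed band + ✓ `heavyTopInst_ten_fourteen`), `25 ≤ m ≤ 31` FALSE
  (✓ `…Negative.HeavyTopInstTenTwentyFive`, admissible tail), `15 ≤ m ≤ 24` OPEN.

Honest framing: instance rows / calibration of the census; nothing here proves or refutes `HeavyTopLaw`/`HeavyTopSlowLaw`, 24318, S3 or 8062; `VP ≠ VNP` is NOT proved.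
No definitions.  [this cell]
-/

noncomputable section

-- single-conjunct layout: Sub = Summit, duplicated namespace component intended
set_option linter.dupNamespace false

namespace Summit.ValiantsHypothesis.ValiantsHypothesis.Theorems.GrenetZeon.HeavyTopThmCUniform

open Matrix
open Summit.ValiantsHypothesis.ValiantsHypothesis.Theorems.GrenetZeon.RadicalSplit
open Summit.ValiantsHypothesis.ValiantsHypothesis.Theorems.GrenetZeon.HeavyTopCompositionBound
  (heavyTopInst_seven_ten_of_iota heavyTopInst_of_choose_two_add_le)

/-! ## The `ι`-column -/

/-- **`ι(n) ≤ C(n,2) − 2` for every `n ≥ 4`** (the `Fin n` shape of ✓ `iota_le`). [this cell] -/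
theorem iota_le_choose_two_sub_two {n : ℕ} (hn : 4 ≤ n) (V : Submodule ℂ (Matrix (Fin n) (Fin n) ℂ)) (hV : ∀ A ∈ V, IsNilpotent A)
    (hirr : ∀ U : Submodule ℂ (Fin n → ℂ), (∀ A ∈ V, ∀ x ∈ U, A *ᵥ x ∈ U) → U = ⊥ ∨ U = ⊤) :
    Module.finrank ℂ V ≤ n.choose 2 - 2 := by
  obtain ⟨s, rfl⟩ : ∃ s, n = s + 1 := ⟨n - 1, by omega⟩
  exact iota_le (by omega) V hV hirr

/-- `ι(8) ≤ 26`. [this cell] -/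
theorem iota_eight_le (V : Submodule ℂ (Matrix (Fin 8) (Fin 8) ℂ)) (hV : ∀ A ∈ V, IsNilpotent A)
    (hirr : ∀ U : Submodule ℂ (Fin 8 → ℂ), (∀ A ∈ V, ∀ x ∈ U, A *ᵥ x ∈ U) → U = ⊥ ∨ U = ⊤) : Module.finrank ℂ V ≤ 26 :=
  (iota_le (s := 7) (by norm_num) V hV hirr).trans (by decide)

/-- `ι(9) ≤ 34`. [this cell] -/
theorem iota_nine_le (V : Submodule ℂ (Matrix (Fin 9) (Fin 9) ℂ)) (hV : ∀ A ∈ V, IsNilpotent A)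
    (hirr : ∀ U : Submodule ℂ (Fin 9 → ℂ), (∀ A ∈ V, ∀ x ∈ U, A *ᵥ x ∈ U) → U = ⊥ ∨ U = ⊤) : Module.finrank ℂ V ≤ 34 :=
  (iota_le (s := 8) (by norm_num) V hV hirr).trans (by decide)

/-- `ι(10) ≤ 43`. [this cell] -/
theorem iota_ten_le (V : Submodule ℂ (Matrix (Fin 10) (Fin 10) ℂ)) (hV : ∀ A ∈ V, IsNilpotent A)
    (hirr : ∀ U : Submodule ℂ (Fin 10 → ℂ), (∀ A ∈ V, ∀ x ∈ U, A *ᵥ x ∈ U) → U = ⊥ ∨ U = ⊤) : Module.finrank ℂ V ≤ 43 :=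
  (iota_le (s := 9) (by norm_num) V hV hirr).trans (by decide)

/-! ## `(7, 10)` down to one datum -/

/-- **`ι(10) ≤ 41 ⟹ HeavyTopInst 7 10`** (✓ `heavyTopInst_seven_ten_of_iota` with `ι(9) ≤ 34` discharged by `iota_nine_le`).  The remaining datum
`ι(10) ≤ 41 = C(10,2) − 4` (deficiency `≥ 4`) is an OPEN finite question (known `ι(10) ∈ [30, 43]`).  Conditional instance row. [this cell] -/
theorem heavyTopInst_seven_ten_of_iota10
    (hι10 : ∀ V : Submodule ℂ (Matrix (Fin 10) (Fin 10) ℂ), (∀ A ∈ V, IsNilpotent A) →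
      (∀ U : Submodule ℂ (Fin 10 → ℂ), (∀ A ∈ V, ∀ x ∈ U, A *ᵥ x ∈ U) → U = ⊥ ∨ U = ⊤) →
      Module.finrank ℂ V ≤ 41) :
    HeavyTopInst 7 10 :=
  heavyTopInst_seven_ten_of_iota iota_nine_le hι10

/-! ## Row `n = 10` -/

/-- **Row `n = 10`, lower part**: `HeavyTopInst 10 m` for every `m ≤ 14` (`m ≤ 13`: the closed band, `C(13,2) + 10 = 88 ≤ 100`; `m = 14`: ✓
`heavyTopInst_ten_fourteen`). [this cell] -/
theorem heavyTopInst_ten_of_le_fourteen {m : ℕ} (hm : m ≤ 14) : HeavyTopInst 10 m := by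
  rcases Nat.lt_or_ge m 14 with h | h
  · refine heavyTopInst_of_choose_two_add_le (by norm_num) ?_
    have h1 : m.choose 2 ≤ Nat.choose 13 2 := Nat.choose_le_choose 2 (by omega)
    have h2 : Nat.choose 13 2 = 78 := by decide
    omega
  · obtain rfl : m = 14 := le_antisymm hm h
    exact heavyTopInst_ten_fourteen

/-- **Row `n = 10` of R2's instance table, as far as the kernel knows it**: `m ≤ 14` TRUE; `25 ≤ m ≤ 31` FALSE (the `(10,25)` placement and its admissible
tail, ✓ `…Negative.HeavyTopInstTenTwentyFive`); `15 ≤ m ≤ 24` OPEN. [this cell] -/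
theorem instanceTable_n10 : (∀ m ≤ 14, HeavyTopInst 10 m) ∧ ∀ m, 25 ≤ m → m ≤ 31 → ¬ HeavyTopInst 10 m := by
  refine ⟨fun _ hm => heavyTopInst_ten_of_le_fourteen hm, fun m h25 h31 => ?_⟩
  interval_cases m
  · exact not_heavyTopInst_ten_twentyfive
  · exact not_heavyTopInst_ten_twentysix
  · exact not_heavyTopInst_ten_twentyseven
  · exact not_heavyTopInst_ten_twentyeight
  · exact not_heavyTopInst_ten_twentynine
  · exact not_heavyTopInst_ten_thirty
  · exact not_heavyTopInst_ten_thirtyone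

end Summit.ValiantsHypothesis.ValiantsHypothesis.Theorems.GrenetZeon.HeavyTopThmCUniform

end
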